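import Summits.Schanuel.Schanuel.Theorems.RootDecomp1KDescent06

/-!
# RootDecomp1KDescentEven — lens 1, generation 72, NODE 33 «THE EVEN TWIST» (CLAIM L3256)

The node-19 descent engine (`RootDecomp1KDescent01–06`: Chevalley–Weil 2-descent to the étale double cover
`z₁² = −A`, `z₂² = Q − A` of `P = x²·Q(Y) + (2x+1)·A(Y)`, then 2-adic Runge on the cover) is re-run for the
square class `A = λ²(Q·T − Y⁶)` with `λ = 2^v·3^j` — the tree's `DescentCert` hard-codes `λ = 3^j` (it needs
`‖λ‖₂ = 1` in the Runge step and `λ` odd in the twist-killing).  For an EVEN `λ` the twist class of a level point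
is `a = 4^v·a′` with `a′` odd, and `(dp)²·a′ + (λ′u³)² = λ′²·F_Q·F_T` (`λ′ = 3^j`) is EXACTLY the shape the tree's
`twist_mod_eight` / `twist_support` / `twist_kill` / `twist_le` consume: `a′ = −9^w`, `w ≤ j`, so `a = −g²` with
`g = 2^v·3^w ∣ λ` (`descent_ev`, §1).  The 2-adic Runge step is re-proved with `‖Rz(y)‖₂ = ‖D‖₂·‖λ‖₂ =: ρ` in
place of `‖D‖₂` (`sign_choice_ev`, `runge_cover_ev`, §2; threshold `2ε < ρ`), the certificate structure
`DescentCertE Q A` (§3) carries `(v, j)`, and §4–§5 re-run the tree's §7/§9 verbatim up to these two changes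
(`exists_sign_small_ev`, `nu_root_of_level_ev`, **`levelFinite_of_descentCertE`**).  §6: the tree's family
certificate `dj*` is polynomial in `λ` and its identities are proved for EVERY `λ : ℤ` (`dj_hT`, `dj_hbez`, `dj_hR`,
`dj_hS`, `dj_hRV`, `dj_hSW`, `dj_hOm`); `ν_λ ≠ 0` for even `λ ≠ 0` (`ν(λ,0) = λ⁴·S(λ²)`, `S ≡ 4 (mod 8)`); hence
**`levelFinite_DJ_even (v j) : LevelFinite (DJ (2^v·3^j))`** for all `v, j` (for `v = 0` this is the tree's
`levelFinite_DJ`), and the census's BOUNDARY CONTROL `DJ 2` (LIVENESS row 42: genus 3, four poles of `x`,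
UNDECIDED of record) is decided HYPOTHESIS-FREE: **`levelFinite_DJ2 : LevelFinite (DJ 2)`**,
**`thinFibreAt_DJ2 (m₀) : ThinFibreAt m₀ (DJ 2)`**; its territory is the tree's `DJ_territory_of_ne_zero`.
Rung 0 — nothing here proves Schanuel, 33364, 33363 or 31077; everything is hypothesis-free; one import; no
Literature import, no `private`, no `set_option`, no `axiom` / `instance` / `sorry` / `native_decide`.
-/

/-!
# RootDecomp1KDescentEven (part 01 of 03) — CENSUS PROVENANCE for lens-1 g72 NODE 33 «THE EVEN TWIST» (CLAIM L3256; crit-1 (g13) PRICE NODE 33 L3259: ×0-AS-RECORD under RULE K-R50 (i) — a λ-support / twist-argument extension of node 19's 2-descent engine —, PORT WELCOME; NODE L3266; crit AUDIT NODE 33 / PORT GO L3269: «NODE 33 STANDS AS A THEOREM — DJ 2 (row 42) and the class DJ (2^v·3^j) decided hypothesis-free at LevelFinite / ThinFibreAt m₀ ∀ m₀; CREDIT ×0-AS-RECORD»; on PORT IDENTITY the census ledger moves row 42 → decided, UNDECIDED OF RECORD ×2 → ×1 = {36 W4})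

(census-1 g27 ×0 record port, `--supports stmt-Schanuel-33364`, no credit to anyone.  SOURCE: the lens's kernel HOME/decomp-schanuel-lens-1/g72/lean/DescentEven.lean sha256 e3ef4100266c9735… (717 l; ONE import `…RootDecomp1KDescent06`; ONE namespace `…Theorems.RootDecomp1KDescentEven` + `section Territory`; 26 theorems + `structure DescentCertE` + `def djCertE`; lens farm rc 0 · 0 sorries · 64 dupNamespace; critic AUDIT L3269: byte identity, farm rc 0, `--axioms` standard ×7, probe rc 0 / CTRL rc 1 (DJ 5), row-42 identity term by term, dependency walker Ridout-free / Literature-free with its own engine `levelFinite_of_descentCertE`) split by the census at the §3/§4 and §5/§6 boundaries for the 400-line cap: part 01 = K l.1–294 (module docstring; §0 small facts; §1 the descent lemma `descent_ev`; §2 the 2-adic Runge step `sign_choice_ev` / `runge_cover_ev`; §3 `structure DescentCertE`); part 02 = K l.295–567 (§4 `exists_sign_small_ev`; §5 the engine `nu_root_of_level_ev` / `levelFinite_of_descentCertE` / `thinFibreAt_of_descentCertE`); part 03 = K l.568–717 (§6 the class DJ (2^v·3^j): `dsNu_dj_ne_zero_even` … `def djCertE` … `levelFinite_DJ2` / `thinFibreAt_DJ2`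 / `bev_DJ2` / `DJ2_not_mem_odd_class`; section Territory `DJ2_decided`); parts 02 / 03 re-open the header (noncomputable section / namespace / the 13 `open` lines = K l.26–44 verbatim) behind `import …RootDecomp1KDescentEven0(k−1)`.  Bodies BYTE-VERBATIM; port-side modifiers: (m1) the three §0 helpers `norm_intCast_le_one_ev` / `isCoprime_num_den_ev` / `odd_psNumer_ev` (gate near-duplicate flags against declarations outside the import cone) are MOVED from part 01 to part 02 as `private` theorems next to their only uses, bodies verbatim; nothing else renamed or changed.  Rung 0; nothing here proves Schanuel, 33364, 33363, 31077, 31987, `ThinFibre 2`, W4 or a binder.)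
-/

noncomputable section

namespace Summit.Schanuel.Schanuel.Theorems.RootDecomp1KDescentEven

open Polynomial LiouvilleNumber
open scoped Nat
open Summit.Schanuel.Schanuel.Theorems.RootDecomp1KTwoBaseCell (psNumer partialSum_eq_psNumer_div coprime_psNumer)
open Summit.Schanuel.Schanuel.Theorems.RootDecomp1KRelLiouvilleCell (partialSum_two_strictMono)
open Summit.Schanuel.Schanuel.Theorems.RootDecomp1KDegreeLadder
open Summit.Schanuel.Schanuel.Theorems.RootDecomp1KXLinear
open Summit.Schanuel.Schanuel.Theorems.RootDecomp1KXLinearII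
open Summit.Schanuel.Schanuel.Theorems.RootDecomp1KXTop
open Summit.Schanuel.Schanuel.Theorems.RootDecomp1KXAll
open Summit.Schanuel.Schanuel.Theorems.RootDecomp1KLevelFinite
open Summit.Schanuel.Schanuel.Theorems.RootDecomp1KThueMahler
open Summit.Schanuel.Schanuel.Theorems.RootDecomp1KParamThueMahler
open Summit.Schanuel.Schanuel.Theorems.RootDecomp1KLocalExponent
open Summit.Schanuel.Schanuel.Theorems.RootDecomp1KRunge
open Summit.Schanuel.Schanuel.Theorems.RootDecomp1KDescent

/-! ### §0 Small facts -/

/-- `2 ⊥ k` for odd `k`. -/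
theorem isCoprime_two_of_odd_ev {k : ℤ} (hk : Odd k) : IsCoprime (2 : ℤ) k := by
  obtain ⟨m, hm⟩ := hk
  exact ⟨-m, 1, by rw [hm]; ring⟩

/-- `‖(2^v : ℂ₂)‖ = (1/2)^v` and `‖(2^v·3^j : ℂ₂)‖ = (1/2)^v`. -/
theorem norm_two_pow_three_pow_ev (v j : ℕ) : ‖(((2 : ℤ) ^ v * 3 ^ j : ℤ) : PadicAlgCl 2)‖ = (1 / 2 : ℝ) ^ v := by
  have h3 : ‖((3 : ℤ) : PadicAlgCl 2)‖ = 1 :=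
    norm_eq_one_of_not_two_dvd (by norm_num)
  push_cast
  rw [norm_mul, norm_pow, norm_pow, norm_two_Cp]
  have : ‖(3 : PadicAlgCl 2)‖ = 1 := by exact_mod_cast h3
  rw [this, one_pow, mul_one]

/-! ### §1 THE DESCENT LEMMA for `λ = 2^v·3^j`: the even twist `a = −4^v·9^w` -/

/-- **DESCENT, even class.**  A level point `p²·F_Q + q(2p+q)·F_A = 0` (`q = 2^e`, `e ≥ 3`, `p` odd, `u ⊥ d`) with
`Q` an Eisenstein-at-3 monic quartic, `Q(0) = 3`, and `A + λ²Y⁶ = λ²·Q·T` with `λ = 2^v·3^j` LIFTS: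
`F_A = −(g·p)²`, `F_Q = g²·q(2p+q)` with `0 < g ∣ λ`, and `u, d` odd.  (The twist class `a` of the lift has
`4^v ∣ a` because `(dp)²` is odd, and `a′ = a/4^v` satisfies the tree's odd-`λ′` identity with `λ′ = 3^j`; the
tree's `twist_mod_eight`, `twist_support`, `twist_kill`, `twist_le` then give `a′ = −9^w`, `w ≤ j`.) -/
theorem descent_ev {p q l u d FQ FA FT q₁ q₂ q₃ : ℤ} {e j v : ℕ} (hq : q = 2 ^ e) (he : 3 ≤ e)
    (hl : l = 2 ^ v * 3 ^ j) (hp : Odd p) (hp0 : 0 < p) (hcop : IsCoprime u d)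
    (hFQ : FQ = u ^ 4 + q₃ * u ^ 3 * d + q₂ * u ^ 2 * d ^ 2 + q₁ * u * d ^ 3 + 3 * d ^ 4) (h₁ : (3 : ℤ) ∣ q₁)
    (hlev : p ^ 2 * FQ + q * (2 * p + q) * FA = 0) (hT : d ^ 2 * FA + l ^ 2 * u ^ 6 = l ^ 2 * FQ * FT) :
    ∃ g : ℤ, 0 < g ∧ g ∣ l ∧ FA = -(g * p) ^ 2 ∧ FQ = g ^ 2 * (q * (2 * p + q)) ∧ Odd u ∧ Odd d := by
  -- (0) `q`
  have hq8 : (8 : ℤ) ∣ q := by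
    rw [hq, show e = 3 + (e - 3) by omega, pow_add]; exact Dvd.intro _ rfl
  have hq2 : (2 : ℤ) ∣ q := dvd_trans (by norm_num) hq8
  -- (1) `p² ⊥ q(2p+q)` and the twist class `a`: `F_A = p²·a`, `F_Q = −a·q(2p+q)`
  have hp2 : IsCoprime p 2 := (isCoprime_two_of_odd_ev hp).symm
  have hpq : IsCoprime p q := by rw [hq]; exact hp2.pow_right
  have hp2q : IsCoprime p (2 * p + q) := by
    have := hpq.add_mul_left_right 2
    rwa [show q + p * 2 = 2 * p + q by ring] at this
  have hcop2 : IsCoprime (p ^ 2) (q * (2 * p + q)) := (hpq.mul_right hp2q).pow_left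
  have hdvd : p ^ 2 ∣ q * (2 * p + q) * FA := ⟨-FQ, by linear_combination hlev⟩
  obtain ⟨a, ha⟩ := hcop2.dvd_of_dvd_mul_left hdvd
  have hFQa : FQ = -a * (q * (2 * p + q)) := by
    have hp2ne : p ^ 2 ≠ 0 := pow_ne_zero 2 hp0.ne'
    apply mul_left_cancel₀ hp2ne
    linear_combination hlev - q * (2 * p + q) * ha
  have hevFQ : Even FQ := by
    obtain ⟨c, hc⟩ := hq2
    exact ⟨-a * (c * (2 * p + q)), by rw [hFQa, hc]; ring⟩
  -- (2) `d` odd, then `u` odd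
  have hdodd : Odd d := by
    by_contra hd
    rw [Int.not_odd_iff_even] at hd
    have hu : Odd u := by
      by_contra hu
      rw [Int.not_odd_iff_even] at hu
      have h1 := hcop.isUnit_of_dvd' (even_iff_two_dvd.mp hu) (even_iff_two_dvd.mp hd)
      exact absurd (Int.isUnit_iff.mp h1) (by decide)
    have hodd : Odd FQ := by
      rw [hFQ, show u ^ 4 + q₃ * u ^ 3 * d + q₂ * u ^ 2 * d ^ 2 + q₁ * u * d ^ 3 + 3 * d ^ 4 =
        u ^ 4 + d * (q₃ * u ^ 3 + q₂ * u ^ 2 * d + q₁ * u * d ^ 2 + 3 * d ^ 3) by ring]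
      exact (hu.pow).add_even (hd.mul_right _)
    exact (Int.not_even_iff_odd.mpr hodd) hevFQ
  have huodd : Odd u := by
    by_contra hu
    rw [Int.not_odd_iff_even] at hu
    have hodd : Odd FQ := by
      rw [hFQ, show u ^ 4 + q₃ * u ^ 3 * d + q₂ * u ^ 2 * d ^ 2 + q₁ * u * d ^ 3 + 3 * d ^ 4 =
        u * (u ^ 3 + q₃ * u ^ 2 * d + q₂ * u * d ^ 2 + q₁ * d ^ 3) + 3 * d ^ 4 by ring]
      exact (hu.mul_right _).add_odd ((show Odd (3 : ℤ) by decide).mul hdodd.pow)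
    exact (Int.not_even_iff_odd.mpr hodd) hevFQ
  -- (3) the even part of the twist: `4^v ∣ a`, `a = 4^v·a′`, and the odd-`λ′` identity for `a′`
  set l' : ℤ := 3 ^ j with hl'
  have hl'odd : Odd l' := Odd.pow (by decide)
  have hid : (d * p) ^ 2 * a + (l * u ^ 3) ^ 2 = l ^ 2 * FQ * FT := by rw [← hT, ha]; ring
  have hdp : Odd (d * p) := hdodd.mul hp
  have h4dvd : (2 : ℤ) ^ (2 * v) ∣ (d * p) ^ 2 * a := by
    refine ⟨l' ^ 2 * (FQ * FT - u ^ 6), ?_⟩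
    have e1 : (d * p) ^ 2 * a = l ^ 2 * FQ * FT - (l * u ^ 3) ^ 2 := by linear_combination hid
    rw [e1, hl]; ring
  have hcop4 : IsCoprime ((2 : ℤ) ^ (2 * v)) ((d * p) ^ 2) := (isCoprime_two_of_odd_ev hdp).pow
  obtain ⟨a', ha'⟩ := hcop4.dvd_of_dvd_mul_left (by rwa [mul_comm] at h4dvd)
  have h4ne : (2 : ℤ) ^ (2 * v) ≠ 0 := pow_ne_zero _ two_ne_zero
  have hid' : (d * p) ^ 2 * a' + (l' * u ^ 3) ^ 2 = l' ^ 2 * FQ * FT := by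
    apply mul_left_cancel₀ h4ne
    have e1 : (2 : ℤ) ^ (2 * v) * ((d * p) ^ 2 * a' + (l' * u ^ 3) ^ 2) =
        (d * p) ^ 2 * a + (l * u ^ 3) ^ 2 := by rw [ha', hl]; ring
    rw [e1, hid, hl]; ring
  -- (4) `a′ ≡ −1 mod 8`, `supp a′ ⊆ {3}`, so `a′ = −9^w`, `w ≤ j`
  have h8FQ : (8 : ℤ) ∣ FQ := by rw [hFQa]; exact (hq8.mul_right _).mul_left _
  have h8a : (8 : ℤ) ∣ a' + 1 := twist_mod_eight hdodd hp hl'odd huodd h8FQ hid'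
  have ha0 : a' ≠ 0 := by rintro rfl; norm_num at h8a
  have haFQ' : a ∣ FQ := ⟨-(q * (2 * p + q)), by rw [hFQa]; ring⟩
  have haFQ : a' ∣ FQ := dvd_trans ⟨(2 : ℤ) ^ (2 * v), by rw [ha']; ring⟩ haFQ'
  have halu : a' ∣ l' ^ 2 * u ^ 6 := by
    have : l' ^ 2 * u ^ 6 = l' ^ 2 * FQ * FT - (d * p) ^ 2 * a' := by linear_combination hid'
    rw [this]
    exact ((haFQ.mul_left _).mul_right _).sub (Dvd.intro_left ((d * p) ^ 2) rfl)
  obtain ⟨w, hw⟩ := twist_kill ha0 h8a (twist_support hl' hcop hFQ haFQ halu)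
  have hwj : w ≤ j := twist_le hl' hcop hFQ h₁ haFQ halu hw
  -- (5) conclusion: `g = 2^v·3^w`
  refine ⟨2 ^ v * 3 ^ w, by positivity, ?_, ?_, ?_, huodd, hdodd⟩
  · rw [hl]; exact mul_dvd_mul_left _ (pow_dvd_pow 3 hwj)
  · rw [ha, ha', hw, show (9 : ℤ) = 3 ^ 2 by norm_num, ← pow_mul]; ring
  · rw [hFQa, ha', hw, show (9 : ℤ) = 3 ^ 2 by norm_num, ← pow_mul]; ring

/-! ### §2 The 2-adic Runge step on the cover with `‖Rz(y)‖₂ = ρ = ‖D‖₂·‖λ‖₂` (the tree's §5 at general `‖λ‖₂`) -/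

/-- **THE SIGN CHOICE** at radius `ρ`: from `Rz² + D²·A(y) = Q(y)³·U₁` with `A(y) = −ζ₁²`, `‖Rz‖ = ρ > 0`,
`‖Q(y)‖ ≤ ε`: one of the two lifts `±ζ₁` has `‖Rz − D·(±ζ₁)‖ ≤ 2ε³/ρ`. -/
theorem sign_choice_ev {Qy Ay ζ₁ D Rz U₁ : PadicAlgCl 2} {ε ρ : ℝ} (hρ : 0 < ρ) (hQ : ‖Qy‖ ≤ ε) (hU1 : ‖U₁‖ ≤ 1)
    (hA : Ay = -ζ₁ ^ 2) (hRid : Rz ^ 2 + D ^ 2 * Ay = Qy ^ 3 * U₁) (hRn : ‖Rz‖ = ρ) :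
    ∃ s : PadicAlgCl 2, (s = 1 ∨ s = -1) ∧ ‖Rz - D * (s * ζ₁)‖ ≤ 2 * ε ^ 3 / ρ := by
  have h2 : ‖(Rz - D * ζ₁) + (Rz + D * ζ₁)‖ = ρ / 2 := by
    rw [show (Rz - D * ζ₁) + (Rz + D * ζ₁) = 2 * Rz by ring, norm_mul, norm_two_Cp, hRn]; ring
  have hprod : ‖(Rz - D * ζ₁) * (Rz + D * ζ₁)‖ ≤ ε ^ 3 := by
    rw [show (Rz - D * ζ₁) * (Rz + D * ζ₁) = Qy ^ 3 * U₁ by linear_combination hRid - D ^ 2 * hA]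
    exact norm_cube_mul_le_ds hQ hU1
  have hm : 0 < ρ / 2 := by positivity
  have e : 2 * ε ^ 3 / ρ = ε ^ 3 / (ρ / 2) := by field_simp
  rcases le_norm_or_le_norm_ds h2 with h | h
  · refine ⟨-1, Or.inr rfl, ?_⟩
    rw [show Rz - D * ((-1) * ζ₁) = Rz + D * ζ₁ by ring, e]
    exact norm_le_div_of_mul_ds hm h (by rwa [mul_comm] at hprod)
  · refine ⟨1, Or.inl rfl, ?_⟩
    rw [one_mul, e]
    exact norm_le_div_of_mul_ds hm h hprod

/-- **THE 2-ADIC RUNGE STEP ON THE COVER** at `‖μ‖ = m ∈ (0, 1]` (`μ = λ`, `m = 2^{−v}`): at a point `(y, ζ₁, ζ₂)`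
of `C'` in `ℂ₂` with `‖y‖ = 1`, `‖Q(y)‖ ≤ ε`, `‖ζ₂ − ζ₁‖ ≤ ε`, `‖Rz(y) − D·ζ₁‖ ≤ 2ε³/(‖D‖m)` and `2ε < ‖D‖·m`, an
integral descent certificate makes `D²·Φ(y, ζ₁, ζ₂)` of size `≤ 2ε³/(‖D‖m)`. -/
theorem runge_cover_ev {y Qy By ζ₁ ζ₂ D μ Rz Sz V W U₂ F0 F1 F2 F3 Ω₁ : PadicAlgCl 2} {ε m : ℝ}
    (hy : ‖y‖ = 1) (hμ : ‖μ‖ = m) (hm0 : 0 < m) (hm1 : m ≤ 1) (hD0 : 0 < ‖D‖) (hD1 : ‖D‖ ≤ 1) (hQ : ‖Qy‖ ≤ ε)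
    (hε1 : 2 * ε < ‖D‖ * m)
    (hV : ‖V‖ ≤ 1) (hW : ‖W‖ ≤ 1) (hU2 : ‖U₂‖ ≤ 1) (hF1 : ‖F1‖ ≤ 1) (hF2 : ‖F2‖ ≤ 1)
    (hF3 : ‖F3‖ ≤ 1) (hΩ1 : ‖Ω₁‖ ≤ 1) (hζ2 : ‖ζ₂‖ ≤ 1) (hB : By = ζ₂ ^ 2) (hζ : ‖ζ₂ - ζ₁‖ ≤ ε)
    (hSid : Sz ^ 2 - D ^ 2 * By = Qy ^ 3 * U₂) (hRV : Rz = D * μ * y ^ 3 + Qy * V) (hSW : Sz = Rz + Qy * W)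
    (hΩ : D ^ 2 * F0 + D * F1 * Rz + D * F2 * Sz + F3 * Rz * Sz = Qy ^ 3 * Ω₁)
    (hR1 : ‖Rz - D * ζ₁‖ ≤ 2 * ε ^ 3 / (‖D‖ * m)) :
    ‖D ^ 2 * F0 + D * F1 * (D * ζ₁) + D * F2 * (D * ζ₂) + F3 * (D * ζ₁) * (D * ζ₂)‖ ≤ 2 * ε ^ 3 / (‖D‖ * m) := by
  set ρ : ℝ := ‖D‖ * m with hρ
  set δ : ℝ := 2 * ε ^ 3 / ρ with hδ
  have hρ0 : 0 < ρ := mul_pos hD0 hm0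
  have hρD : ρ ≤ ‖D‖ := by rw [hρ]; exact mul_le_of_le_one_right (norm_nonneg _) hm1
  have hρ1 : ρ ≤ 1 := hρD.trans hD1
  have hε0 : 0 ≤ ε := (norm_nonneg _).trans hQ
  have hερ : ε < ρ := by linarith
  have hεD : ε < ‖D‖ := lt_of_lt_of_le hερ hρD
  have hε3 : ε ^ 3 ≤ δ := by
    rw [hδ, le_div_iff₀ hρ0]; nlinarith [pow_nonneg hε0 3]
  have hδε : δ ≤ ε := by
    rw [hδ, div_le_iff₀ hρ0]
    have h2ε : 2 * ε ≤ 1 := by linarith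
    calc 2 * ε ^ 3 = (2 * ε) * (ε * ε) := by ring
      _ ≤ 1 * (ε * ε) := mul_le_mul_of_nonneg_right h2ε (mul_nonneg hε0 hε0)
      _ = ε * ε := one_mul _
      _ ≤ ε * ρ := mul_le_mul_of_nonneg_left hερ.le hε0
  have hone : ∀ {a b : PadicAlgCl 2}, ‖a‖ ≤ 1 → ‖b‖ ≤ 1 → ‖a * b‖ ≤ 1 := fun ha hb => by
    rw [norm_mul]; exact mul_le_one₀ ha (norm_nonneg _) hb
  -- `‖Rz‖ = ‖Sz‖ = ρ`
  have hRn : ‖Rz‖ = ρ := by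
    have h1 : ‖D * μ * y ^ 3‖ = ρ := by rw [norm_mul, norm_mul, norm_pow, hμ, hy]; ring
    have h2 : ‖Qy * V‖ < ‖D * μ * y ^ 3‖ := by
      rw [h1, norm_mul]; exact lt_of_le_of_lt (mul_le_of_le_one_right (norm_nonneg _) hV) (hQ.trans_lt hερ)
    rw [hRV, norm_add_eq_of_lt_ds h2, h1]
  have hSn : ‖Sz‖ = ρ := by
    have h2 : ‖Qy * W‖ < ‖Rz‖ := by
      rw [hRn, norm_mul]; exact lt_of_le_of_lt (mul_le_of_le_one_right (norm_nonneg _) hW) (hQ.trans_lt hερ)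
    rw [hSW, norm_add_eq_of_lt_ds h2, hRn]
  -- `‖Sz − Dζ₂‖ ≤ ε`, then `≤ δ`
  have hS1 : ‖Sz - D * ζ₂‖ ≤ ε := by
    have e : Sz - D * ζ₂ = (Qy * W + (Rz - D * ζ₁)) - D * (ζ₂ - ζ₁) := by rw [hSW]; ring
    rw [e]
    refine norm_sub_le_of_le_ds (norm_add_le_of_le_ds ?_ (hR1.trans hδε)) ?_
    · rw [norm_mul]; exact (mul_le_of_le_one_right (norm_nonneg _) hW).trans hQ
    · rw [norm_mul]; exact (mul_le_mul hD1 hζ (norm_nonneg _) zero_le_one).trans (by rw [one_mul])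
  have hS2 : ρ / 2 ≤ ‖Sz + D * ζ₂‖ := by
    have e : Sz + D * ζ₂ = 2 * Sz - (Sz - D * ζ₂) := by ring
    have h2S : ‖(2 : PadicAlgCl 2) * Sz‖ = ρ / 2 := by rw [norm_mul, norm_two_Cp, hSn]; ring
    rw [e, norm_sub_eq_of_lt_ds (by rw [h2S]; linarith), h2S]
  have hSδ : ‖Sz - D * ζ₂‖ ≤ δ := by
    have hprod : ‖(Sz - D * ζ₂) * (Sz + D * ζ₂)‖ ≤ ε ^ 3 := by
      rw [show (Sz - D * ζ₂) * (Sz + D * ζ₂) = Qy ^ 3 * U₂ by linear_combination hSid + D ^ 2 * hB]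
      exact norm_cube_mul_le_ds hQ hU2
    have := norm_le_div_of_mul_ds (by positivity : 0 < ρ / 2) hS2 hprod
    rw [hδ]; convert this using 1; field_simp
  -- the value of `D²Φ`
  have e : D ^ 2 * F0 + D * F1 * (D * ζ₁) + D * F2 * (D * ζ₂) + F3 * (D * ζ₁) * (D * ζ₂) =
      (D ^ 2 * F0 + D * F1 * Rz + D * F2 * Sz + F3 * Rz * Sz) +
      ((D * F1 * (D * ζ₁ - Rz) + D * F2 * (D * ζ₂ - Sz)) +
        (F3 * (D * ζ₂) * (D * ζ₁ - Rz) + F3 * Rz * (D * ζ₂ - Sz))) := by ring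
  rw [e, hΩ]
  have hR1' : ‖D * ζ₁ - Rz‖ ≤ δ := by rw [norm_sub_rev]; exact hR1
  have hS1' : ‖D * ζ₂ - Sz‖ ≤ δ := by rw [norm_sub_rev]; exact hSδ
  have hDζ2 : ‖D * ζ₂‖ ≤ 1 := hone hD1 hζ2
  have key : ∀ {c x : PadicAlgCl 2}, ‖c‖ ≤ 1 → ‖x‖ ≤ δ → ‖c * x‖ ≤ δ := fun hc hx => by
    rw [norm_mul]
    calc _ ≤ 1 * δ := mul_le_mul hc hx (norm_nonneg _) zero_le_one
      _ = δ := one_mul δ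
  refine norm_add_le_of_le_ds ((norm_cube_mul_le_ds hQ hΩ1).trans hε3) (norm_add_le_of_le_ds ?_ ?_)
  · exact norm_add_le_of_le_ds (key (hone hD1 hF1) hR1') (key (hone hD1 hF2) hS1')
  · exact norm_add_le_of_le_ds (key (hone hF3 hDζ2) hR1') (key (hone hF3 (hRn.le.trans hρ1)) hS1')

/-! ### §3 THE INTEGRAL DESCENT CERTIFICATE for `λ = 2^v·3^j` -/

/-- **AN INTEGRAL DESCENT CERTIFICATE, even class** for the pair `(Q, A)` (`P = x²Q + (2x+1)A`, cover
`z₁² = −A`, `z₂² = Q − A`): exactly the tree's `DescentCert` with `λ = 2^v·3^j` in place of `3^j` in the two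
fields `hT` (`A + λ²Y⁶ = λ²·Q·T`) and `hRV` (`Rz = D·λ·Y³ + Q·V`). -/
structure DescentCertE (Q A : ℤ[X]) where
  (v j : ℕ) (T Ba Bb Rz Sz V W U₁ U₂ F0 F1 F2 F3 Om : ℤ[X]) (m D : ℤ)
  eis : EisQ Q
  hA : A.natDegree ≤ 3
  hTdeg : T.natDegree ≤ 2
  hT : A + (((2 : ℤ) ^ v * 3 ^ j : ℤ) : ℤ[X]) ^ 2 * X ^ 6 = (((2 : ℤ) ^ v * 3 ^ j : ℤ) : ℤ[X]) ^ 2 * Q * T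
  hbez : Ba * A + Bb * (Q - A) = (m : ℤ[X])
  hm : m ≠ 0
  hD : D ≠ 0
  hR : Rz ^ 2 + (D : ℤ[X]) ^ 2 * A = Q ^ 3 * U₁
  hS : Sz ^ 2 - (D : ℤ[X]) ^ 2 * (Q - A) = Q ^ 3 * U₂
  hRV : Rz = (D : ℤ[X]) * (((2 : ℤ) ^ v * 3 ^ j : ℤ) : ℤ[X]) * X ^ 3 + Q * V
  hSW : Sz = Rz + Q * W
  hF0 : F0.natDegree ≤ 5
  hF1 : F1.natDegree ≤ 3
  hF2 : F2.natDegree ≤ 3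
  hF3 : F3.natDegree ≤ 1
  hOm : (D : ℤ[X]) ^ 2 * F0 + (D : ℤ[X]) * F1 * Rz + (D : ℤ[X]) * F2 * Sz + F3 * Rz * Sz = Q ^ 3 * Om
  hnu : dsNu Q A F0 F1 F2 F3 ≠ 0

end Summit.Schanuel.Schanuel.Theorems.RootDecomp1KDescentEven

end
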